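import Mathlib
import HarnessLib
import Summits.NavierStokesRegularity.NavierStokesRegularity.Theorems.RellichScarTypeIBlowupProfile
import Summits.NavierStokesRegularity.NavierStokesRegularity.Theorems.LocalSineTubeDoorLocalPointZoomZoom
import Summits.NavierStokesRegularity.NavierStokesRegularity.Theorems.LocalSineTubeDoorLocalPointZoomRate

/-!
# STAGED door S15 `LocalIrrotationalScarDoor` (nsreg-p1 ROUND-14), zoom crux `K1Rep` (`LocalPointZoomScarCurlRep`) —
# support file: the tree zoom frame at a LOCALLY Type I point WITH ITS SUITABLE-WEAK LIMIT DATA EXPOSED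

This is `…Theorems.LocalSineTubeDoorLocalPointZoomFrame.localTreeZoomFrame` (seat p6 g5, helper of
stmt-NavierStokesRegularity-20017) run verbatim, with the conclusion ENLARGED by the limit's suitable-weak data that
the original kept internal (ROUND-14 §4 Day 2 step (i)): the pressure `ϖ` and weak gradient `H` of the `L³_loc` limit
`w`, `IsSuitableWeakSolutionOn (slab) 1 0 w ϖ`, `HasWeakSpatialGradientOn (slab) w H`, `typeIBound (ℝ₋ × ℝ³) w ϖ H < ⊤`,
`IsBackwardSingularPoint w 0`, and the measurability of the zooms / of `w` on every `Q(0,a)` (inputs of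
`…LocalIrrotationalScarDoorZoomApex.ae_apex_of_zoomLimit`).  Everything else (and the proof) is the original's:

Cell ns-regularity-ideate, seat p6 (route-directed support, `--supports stmt-NavierStokesRegularity-20017`).
Local version of the cell's `Cell.NsRegP1c.treeZoomFrame` (Sketch8A; = body of the tree's
`Theorems.RellichScarTypeIBlowupProfile.typeIBlowupProfile_proof` at a prescribed point with the frame data
exposed): steps (1) zoom (`exists_zoom_typeIBound_lt_top_of_localTypeI`, A–B Lemma 2.5 in place of the Morrey
bound + Lemma 2.6), (2) the origin is backward-singular (`SereginSverak2002.isBackwardBoundedAt_of_zoom`),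
(3) the LOCAL Type-I rate of the zoom, (4) the half-zoom of class `Q(0,2)`, (5)–(6) the zoom-in limit at
the singular origin (`Seregin2020.exists_ancientLimit`, Seregin 2014 Prop. 6.20), (7) the slab class with
`𝐈 ≤ 4 𝐈(Q(0,1))` (`slab_typeIBound_of_zoomLimit`), (8) the rate a.e. on the slab
(`ae_rate_of_zoomLimit_of_ball` — the local rate region exhausts `ℝ³` under the zoom-in), (9) the
representative in the route's profile class (`exists_profile_repr`), (10) the identification of the zooms
with `(s,y) ↦ (Rλⱼ/2ν) u(T + (Rλⱼ/2)² s/ν, x₀ + (Rλⱼ/2) y)`, (11) Seregin's pressure energies at the origin.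

Sources: Albritton–Barker 2019 (arXiv:1811.00502) §3; Seregin 2014 Prop. 6.20; Seregin–Šverák 2002/2009;
KNSS 2009.  WHAT THIS IS NOT: not a claim about Navier–Stokes regularity; a support lemma for an OPEN crux of a
DRAFT route (the zoom FRAME exists; the route's statement additionally needs pointwise vorticity convergence).
-/

noncomputable section

-- the summit and its single sub-problem share the name (CONVENTIONS §1), as in every Theorems file
set_option linter.dupNamespace false

namespace Summit.NavierStokesRegularity.NavierStokesRegularity.Theorems.LocalIrrotationalScarDoorZoomFrameSuitable

open MeasureTheory Set Function Filter Topology TopologicalSpace Metric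
open Literature.Analysis Literature.Analysis.FluidPDE Literature.Analysis.FluidPDE.SereginSverak2009
open Summit.NavierStokesRegularity.NavierStokesRegularity.Theorems
open Summit.NavierStokesRegularity.NavierStokesRegularity.Theorems.LocalSineTubeDoorLocalPointZoomZoom
open Summit.NavierStokesRegularity.NavierStokesRegularity.Theorems.LocalSineTubeDoorLocalPointZoomRate
open scoped NNReal ENNReal

/-- **The tree zoom frame at a prescribed LOCALLY Type I point, with the suitable-weak limit data exposed**
(`localTreeZoomFrame` of `…LocalSineTubeDoorLocalPointZoomFrame` plus: pressure `ϖ` and weak gradient `H` of the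
limit `w`, suitability on the slab, `𝐈(ℝ₋ × ℝ³) < ⊤`, the backward-singular origin of `w` itself, measurability of
the zooms and of `w` on the cylinders `Q(0,a)`).  Original docstring: the cell's `treeZoomFrame` =
body of `Theorems.RellichScarTypeIBlowupProfile.typeIBlowupProfile_proof` run at a prescribed
non-backward-bounded point, with ALL frame data exposed), localised: the zoom of
`…LocalSineTubeDoorLocalPointZoomZoom.exists_zoom_typeIBound_lt_top_of_localTypeI` (A–B Lemma 2.5 instead
of the Morrey bound), the half-zoom `v'`, its pressure `π'` of class `Q(0,1)`, Seregin's scales `λⱼ` and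
pressure energies at the singular origin, the `L³_loc` limit `w = v₁` a.e. with `v₁` in the ROUTE's profile
class (Type-I rate from the LOCAL rate of `u`, continuous, Oseen-mild, divergence-free) and a
backward-singular origin, and the identification of the zooms with
`(s, y) ↦ (Rλⱼ/2ν) u(T + (Rλⱼ/2)² s/ν, x₀ + (Rλⱼ/2) y)`. -/
theorem localTreeZoomFrame_suitable {ν T : ℝ} (hν : 0 < ν) (hT : 0 < T)
    {u : ℝ → EuclideanSpace ℝ (Fin 3) → EuclideanSpace ℝ (Fin 3)} {p : ℝ → EuclideanSpace ℝ (Fin 3) → ℝ}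
    (hsol : IsClassicalNSSolutionOn (Ico 0 T) ν 0 u p) (hLH : IsLerayHopfOn T ν 0 (u 0) u)
    {x₀ : EuclideanSpace ℝ (Fin 3)} {ρ M : ℝ} (hρ : 0 < ρ)
    (hM : ∀ t ∈ Ico 0 T, T - ρ ^ 2 < t → ∀ x ∈ ball x₀ ρ, ‖u t x‖ * Real.sqrt (ν * (T - t)) ≤ M)
    (hnotbd : ¬ IsBackwardBoundedAt u T x₀) :
    ∃ (R C₁ : ℝ) (v' : ℝ → EuclideanSpace ℝ (Fin 3) → EuclideanSpace ℝ (Fin 3))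
      (π' : ℝ → EuclideanSpace ℝ (Fin 3) → ℝ) (lam : ℕ → ℝ)
      (w v₁ : ℝ → EuclideanSpace ℝ (Fin 3) → EuclideanSpace ℝ (Fin 3))
      (ϖ : ℝ → EuclideanSpace ℝ (Fin 3) → ℝ)
      (H : ℝ → EuclideanSpace ℝ (Fin 3) → EuclideanSpace ℝ (Fin 3) →L[ℝ] EuclideanSpace ℝ (Fin 3))
      (Ks : ℝ≥0) (r₁ : ℝ), 0 < R ∧ (∀ j, 0 < lam j) ∧ Tendsto lam atTop (𝓝 0) ∧
      IsSuitableWeakSolutionInBall 1 0 v' π' ∧ 0 < r₁ ∧ r₁ ≤ 1 ∧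
      (∀ r ∈ Ioc (0 : ℝ) r₁, cknD r (0 : ℝ × EuclideanSpace ℝ (Fin 3)) π' ≤ Ks) ∧
      (∀ a : ℝ, 0 < a → Tendsto (fun j => eLpNorm
        (uncurry ((lam j) • stPull ((lam j) ^ 2) (lam j) (0 : ℝ) (0 : EuclideanSpace ℝ (Fin 3)) v') -
          uncurry w) 3
        (volume.restrict (parabolicCylinder a (0 : ℝ × EuclideanSpace ℝ (Fin 3))))) atTop (𝓝 0)) ∧
      (IsSuitableWeakSolutionOn (slab (EuclideanSpace ℝ (Fin 3)) (Iio 0) isOpen_Iio) 1 0 w ϖ ∧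
        HasWeakSpatialGradientOn (slab (EuclideanSpace ℝ (Fin 3)) (Iio 0) isOpen_Iio) w H ∧
        typeIBound (Iio (0 : ℝ) ×ˢ univ) w ϖ H < ⊤ ∧
        IsBackwardSingularPoint w (0 : ℝ × EuclideanSpace ℝ (Fin 3)) ∧
        (∀ a : ℝ, 0 < a → ∀ᶠ j in atTop, AEStronglyMeasurable
          (uncurry ((lam j) • stPull ((lam j) ^ 2) (lam j) (0 : ℝ) (0 : EuclideanSpace ℝ (Fin 3)) v'))
          (volume.restrict (parabolicCylinder a (0 : ℝ × EuclideanSpace ℝ (Fin 3))))) ∧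
        (∀ a : ℝ, 0 < a → AEStronglyMeasurable (uncurry w)
          (volume.restrict (parabolicCylinder a (0 : ℝ × EuclideanSpace ℝ (Fin 3)))))) ∧
      (∀ᵐ x ∂(volume.restrict (Iio (0 : ℝ) ×ˢ (univ : Set (EuclideanSpace ℝ (Fin 3))))),
        uncurry w x = uncurry v₁ x) ∧
      (HasTypeITimeDecay C₁ v₁ ∧ ContinuousOn (uncurry v₁) (Iio (0 : ℝ) ×ˢ univ) ∧
        (∀ s t : ℝ, s < t → t < 0 → ∀ x, v₁ t x =
          UnboundedOperators.heatExtension (v₁ s) (t - s) x - oseenDuhamel 1 s v₁ v₁ t x) ∧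
        (∀ t < 0, VectorCalculus.IsDivFree (v₁ t))) ∧
      IsBackwardSingularPoint v₁ 0 ∧
      ∀ (j : ℕ) (s : ℝ) (y : EuclideanSpace ℝ (Fin 3)),
        ((lam j) • stPull ((lam j) ^ 2) (lam j) (0 : ℝ) (0 : EuclideanSpace ℝ (Fin 3)) v') s y =
          ((R * (lam j / 2)) / ν) • u (T + (R * (lam j / 2)) ^ 2 * s / ν) (x₀ + (R * (lam j / 2)) • y) := by
  -- ## (1) the viscosity-normalising zoom at the locally Type I point (A–B Lemma 2.5, rate case)
  obtain ⟨R, α, β, hR, hα, hβ, hβR, hαR, hβT, -, -, hball, hGv, hratev, htypeI⟩ :=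
    exists_zoom_typeIBound_lt_top_of_localTypeI hν hT hsol hLH hρ hM
  have hρR : 0 < ρ / R := div_pos hρ hR
  set q : ℝ → EuclideanSpace ℝ (Fin 3) → ℝ :=
    fun t x => p t x - (p t 0 - normalisedPressure (u t) 0) with hq
  set v : ℝ → EuclideanSpace ℝ (Fin 3) → EuclideanSpace ℝ (Fin 3) := α • stPull β R T x₀ u with hv
  set πv : ℝ → EuclideanSpace ℝ (Fin 3) → ℝ := α ^ 2 • stPull β R T x₀ q with hπv
  set Gv : ℝ → EuclideanSpace ℝ (Fin 3) → EuclideanSpace ℝ (Fin 3) →L[ℝ] EuclideanSpace ℝ (Fin 3) :=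
    (α * R) • stPull β R T x₀ (fun t x => fderiv ℝ (u t) x) with hGvdef
  -- ## (2) the origin is a backward singular point of the zoom
  have hsing : IsBackwardSingularPoint v (0 : ℝ × EuclideanSpace ℝ (Fin 3)) := by
    intro r hr
    by_contra hfin
    have hfin' : eLpNorm (uncurry v) ⊤
        (volume.restrict (parabolicCylinder (min r 1) (0 : ℝ × EuclideanSpace ℝ (Fin 3)))) < ⊤ := by
      refine lt_of_le_of_lt (eLpNorm_mono_measure _ (Measure.restrict_mono ?_ le_rfl))
        (lt_top_iff_ne_top.2 hfin)
      exact SuitableCompactness.parabolicCylinder_zero_mono (le_min hr.le zero_le_one) (min_le_left _ _)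
    exact hnotbd (SereginSverak2002.isBackwardBoundedAt_of_zoom hsol x₀ hR hα hβ hβT
      (lt_min hr one_pos) (min_le_right _ _) hfin')
  -- ## (3) the rate of the zoom on `(-1, 0) × B(0, ρ/R)` (from the LOCAL rate of `u`)
  set C₁ : ℝ := α * max M 0 / Real.sqrt (ν * β) with hC₁def
  have hC₁ : 0 ≤ C₁ := by positivity
  -- ## (4) the second zoom by `1/2`: the class on `Q(0, 2) ⊇ 𝒞 × (−1, 0)`
  have hc : (0 : ℝ) < 1 / 2 := by norm_num
  set v' : ℝ → EuclideanSpace ℝ (Fin 3) → EuclideanSpace ℝ (Fin 3) :=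
    (1 / 2 : ℝ) • stPull ((1 / 2 : ℝ) ^ 2) (1 / 2) (0 : ℝ) (0 : EuclideanSpace ℝ (Fin 3)) v with hv'
  set π' : ℝ → EuclideanSpace ℝ (Fin 3) → ℝ :=
    (1 / 2 : ℝ) ^ 2 • stPull ((1 / 2 : ℝ) ^ 2) (1 / 2) (0 : ℝ) (0 : EuclideanSpace ℝ (Fin 3)) πv
    with hπ'
  set G' : ℝ → EuclideanSpace ℝ (Fin 3) → EuclideanSpace ℝ (Fin 3) →L[ℝ] EuclideanSpace ℝ (Fin 3) :=
    (1 / 2 : ℝ) ^ 2 • stPull ((1 / 2 : ℝ) ^ 2) (1 / 2) (0 : ℝ) (0 : EuclideanSpace ℝ (Fin 3)) Gv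
    with hG'def
  have hball' : IsSuitableWeakSolutionInBall 2 0 v' π' := by
    have h := hball.zoomOut hc
    rwa [show (1 : ℝ) / (1 / 2) = 2 by norm_num] at h
  have hG' : HasWeakSpatialGradientOn
      (parabolicCylinderOpens 2 (0 : ℝ × EuclideanSpace ℝ (Fin 3))) v' G' := by
    have h := hGv.stRescale (1 / 2 : ℝ) (pow_pos hc 2) hc (0 : ℝ) (0 : EuclideanSpace ℝ (Fin 3))
    have hpre : stPreimage ((1 / 2 : ℝ) ^ 2) (1 / 2) (0 : ℝ) (0 : EuclideanSpace ℝ (Fin 3))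
        (parabolicCylinderOpens 1 (0 : ℝ × EuclideanSpace ℝ (Fin 3))) =
        parabolicCylinderOpens 2 (0 : ℝ × EuclideanSpace ℝ (Fin 3)) := by
      apply Opens.ext
      rw [coe_stPreimage, coe_parabolicCylinderOpens, coe_parabolicCylinderOpens,
        stAffine_preimage_parabolicCylinder_zero hc, show (1 : ℝ) / (1 / 2) = 2 by norm_num]
    rw [hpre, ← sq] at h
    exact h
  have hI' : typeIBound (parabolicCylinder 1 (0 : ℝ × EuclideanSpace ℝ (Fin 3))) v' π' G' < ⊤ := by
    have h := typeIBound_nsZoom hc (0 : ℝ) (0 : EuclideanSpace ℝ (Fin 3))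
      (parabolicCylinder (1 / 2) (0 : ℝ × EuclideanSpace ℝ (Fin 3))) v πv Gv
    rw [stAffine_preimage_parabolicCylinder_zero hc, show (1 / 2 : ℝ) / (1 / 2) = 1 by norm_num] at h
    rw [hv', hπ', hG'def, h]
    exact htypeI
  have hsing' : IsBackwardSingularPoint v' (0 : ℝ × EuclideanSpace ℝ (Fin 3)) := by
    intro r hr
    rw [hv', eLpNorm_top_nsZoom hc, Seregin2020.stAffine_zero_zero_apply_zero,
      hsing ((1 / 2) * r) (by positivity)]
    exact ENNReal.mul_top (by simp)
  have hratev' : ∀ s ∈ Ioo (-((1 : ℝ) / (1 / 2 : ℝ) ^ 2)) 0,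
      ∀ y ∈ ball (0 : EuclideanSpace ℝ (Fin 3)) ((ρ / R) / (1 / 2 : ℝ)), ‖v' s y‖ ≤ C₁ / Real.sqrt (-s) :=
    fun s hs y hy => norm_nsZoom_le_rate_of_ball hc hratev hs hy
  -- ## (5) the inputs of the zoom-in extraction on `𝒞 × (−1, 0) ⊆ Q(0, 2)`
  have hsqrt2 : Real.sqrt 2 ≤ 2 := by
    rw [Real.sqrt_le_left (by norm_num)]
    norm_num
  have hPQ : parCyl (0 : ℝ × EuclideanSpace ℝ (Fin 3)) 1 ⊆
      parabolicCylinder 2 (0 : ℝ × EuclideanSpace ℝ (Fin 3)) := by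
    intro z hz
    obtain ⟨ht, hx⟩ := hz
    have hx' := spaceCyl_subset_ball (0 : EuclideanSpace ℝ (Fin 3)) zero_le_one hx
    rw [mul_one, mem_ball_zero_iff] at hx'
    simp only [Prod.fst_zero, one_pow, zero_sub, mem_Ioo] at ht
    rw [SuitableCompactness.mem_parabolicCylinder_zero]
    exact ⟨⟨by linarith [ht.1], ht.2⟩, lt_of_lt_of_le hx' hsqrt2⟩
  have hle : parCylOpens (0 : ℝ × EuclideanSpace ℝ (Fin 3)) 1 ≤
      parabolicCylinderOpens 2 (0 : ℝ × EuclideanSpace ℝ (Fin 3)) := fun z hz => hPQ hz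
  have hsw3 : IsSuitableWeakSolutionOn (parCylOpens (0 : ℝ × EuclideanSpace ℝ (Fin 3)) 1) 1 0 v' π' :=
    IsSuitableWeakSolutionOn.mono_holds hball'.1 hle
  have hA3 : ∃ Cc : ℝ≥0, ∀ᵐ t ∂(volume.restrict (Ioo (-1 : ℝ) 0)),
      ∫⁻ x in spaceCyl (0 : EuclideanSpace ℝ (Fin 3)) 1, ‖v' t x‖ₑ ^ 2 ≤ Cc := by
    obtain ⟨Cc, hCc⟩ := hball'.2.1
    refine ⟨Cc, ?_⟩
    have hsub : Ioo (-1 : ℝ) 0 ⊆ Ioo ((0 : ℝ × EuclideanSpace ℝ (Fin 3)).1 - 2 ^ 2)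
        (0 : ℝ × EuclideanSpace ℝ (Fin 3)).1 := by
      intro t ht
      simp only [Prod.fst_zero, zero_sub, mem_Ioo]
      exact ⟨by linarith [ht.1], ht.2⟩
    have hballsub : spaceCyl (0 : EuclideanSpace ℝ (Fin 3)) 1 ⊆
        ball (0 : ℝ × EuclideanSpace ℝ (Fin 3)).2 2 := by
      refine (spaceCyl_subset_ball (0 : EuclideanSpace ℝ (Fin 3)) zero_le_one).trans ?_
      rw [mul_one, Prod.snd_zero]
      exact ball_subset_ball hsqrt2
    filter_upwards [ae_restrict_of_ae_restrict_of_subset hsub hCc] with t ht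
    exact (lintegral_mono_set hballsub).trans ht
  have hG3 : HasWeakSpatialGradientOn (parCylOpens (0 : ℝ × EuclideanSpace ℝ (Fin 3)) 1) v' G' :=
    hG'.mono hle
  have hE3 : ∫⁻ z in parCyl (0 : ℝ × EuclideanSpace ℝ (Fin 3)) 1,
      ENNReal.ofReal (frobeniusNormSq (G' z.1 z.2)) < ∞ := by
    obtain ⟨G'', hG'', hG''2⟩ := hball'.2.2.1
    have hae := hG'.ae_eq hG''
    rw [coe_parabolicCylinderOpens] at hae
    refine lt_of_le_of_lt (lintegral_mono_set hPQ) ?_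
    have e : ∫⁻ z in parabolicCylinder 2 (0 : ℝ × EuclideanSpace ℝ (Fin 3)),
        ENNReal.ofReal (frobeniusNormSq (G' z.1 z.2)) =
        ∫⁻ z in parabolicCylinder 2 (0 : ℝ × EuclideanSpace ℝ (Fin 3)),
        ENNReal.ofReal (frobeniusNormSq (G'' z.1 z.2)) := by
      refine lintegral_congr_ae ?_
      filter_upwards [hae] with z hz
      have hz' : G' z.1 z.2 = G'' z.1 z.2 := hz
      rw [hz']
    rw [e]
    exact hG''2
  have hp3 : ∫⁻ z in parCyl (0 : ℝ × EuclideanSpace ℝ (Fin 3)) 1,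
      ‖π' z.1 z.2‖ₑ ^ (3 / 2 : ℝ) < ∞ := by
    obtain ⟨h32, h32', h32r⟩ := threeHalves_facts
    have hm : MemLp (uncurry π') (3 / 2)
        (volume.restrict (parabolicCylinder 2 (0 : ℝ × EuclideanSpace ℝ (Fin 3)))) := hball'.2.2.2
    have h2 := hm.2
    rw [eLpNorm_eq_lintegral_rpow_enorm_toReal (by norm_num) h32', h32r] at h2
    have hfin : ∫⁻ z in parabolicCylinder 2 (0 : ℝ × EuclideanSpace ℝ (Fin 3)),
        ‖uncurry π' z‖ₑ ^ (3 / 2 : ℝ) < ∞ := by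
      by_contra htop
      rw [not_lt, top_le_iff] at htop
      rw [htop, ENNReal.top_rpow_of_pos (by norm_num)] at h2
      exact lt_irrefl _ h2
    exact lt_of_le_of_lt (lintegral_mono_set hPQ) hfin
  have hI3 : Seregin2020.blowupIndex 0 v' G' < ∞ := by
    refine lt_of_le_of_lt (Seregin2020.blowupIndex_le_limsup_cknC 0 v' G') (lt_of_le_of_lt ?_ hI')
    refine limsup_le_of_le (by isBoundedDefault) ?_
    filter_upwards [Ioo_mem_nhdsGT (zero_lt_one' ℝ)] with r hr
    exact cknC_le_abScaledSum.trans (abScaledSum_le_typeIBound hr.1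
      (SuitableCompactness.parabolicCylinder_zero_mono hr.1.le hr.2.le))
  -- ## (6) the zoom-in limit at the singular origin
  obtain ⟨K, κ, lam, w, ϖ, -, hlam, hlam0, hsingw, hlimw⟩ :=
    Seregin2020.exists_ancientLimit hsw3 hA3 hG3 hE3 hp3 hsing' hI3
  -- ## (7) the slab class with `𝐈 ≤ 4 𝐈(Q(0,1))`
  have hball1 : IsSuitableWeakSolutionInBall 1 0 v' π' :=
    SuitableCompactness.isSuitableWeakSolutionInBall_of_le_radius hball' (by norm_num) (by norm_num)
  have hG1 : HasWeakSpatialGradientOn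
      (parabolicCylinderOpens 1 (0 : ℝ × EuclideanSpace ℝ (Fin 3))) v' G' :=
    hG'.mono (SuitableCompactness.parabolicCylinderOpens_zero_mono (by norm_num) (by norm_num))
  obtain ⟨hsww, H, hH, h4I⟩ := slab_typeIBound_of_zoomLimit
    (typeIBound (parabolicCylinder 1 (0 : ℝ × EuclideanSpace ℝ (Fin 3))) v' π' G') hI' one_pos
    hball1 hG1 le_rfl hlam hlam0
    (fun a ha => ⟨(hlimw a ha).1, (hlimw a ha).2.1, (hlimw a ha).2.2.1, (hlimw a ha).2.2.2.1⟩)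
  -- ## (8) the rate, almost everywhere on the slab
  have hvm : ∀ a : ℝ, 0 < a → ∀ᶠ j in atTop, AEStronglyMeasurable
      (uncurry ((lam j) • stPull ((lam j) ^ 2) (lam j) (0 : ℝ) (0 : EuclideanSpace ℝ (Fin 3)) v'))
      (volume.restrict (parabolicCylinder a (0 : ℝ × EuclideanSpace ℝ (Fin 3)))) := by
    intro a ha
    have hev : ∀ᶠ j in atTop, lam j < 1 / a := hlam0 (Iio_mem_nhds (by positivity))
    filter_upwards [hev] with j hj
    have hμ := hlam j
    have h := hG1.stRescale (lam j) (pow_pos hμ 2) hμ (0 : ℝ) (0 : EuclideanSpace ℝ (Fin 3))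
    have hsub : parabolicCylinder a (0 : ℝ × EuclideanSpace ℝ (Fin 3)) ⊆
        ((stPreimage ((lam j) ^ 2) (lam j) (0 : ℝ) (0 : EuclideanSpace ℝ (Fin 3))
          (parabolicCylinderOpens 1 (0 : ℝ × EuclideanSpace ℝ (Fin 3))) :
            Opens (ℝ × EuclideanSpace ℝ (Fin 3))) : Set (ℝ × EuclideanSpace ℝ (Fin 3))) := by
      rw [coe_stPreimage, coe_parabolicCylinderOpens, stAffine_preimage_parabolicCylinder_zero hμ]
      refine SuitableCompactness.parabolicCylinder_zero_mono ha.le ?_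
      rw [le_div_iff₀ hμ, mul_comm]
      exact ((lt_div_iff₀ ha).1 hj).le
    exact h.locallyIntegrableOn.aestronglyMeasurable.mono_measure (Measure.restrict_mono hsub le_rfl)
  have hae_rate := ae_rate_of_zoomLimit_of_ball (by positivity : (0 : ℝ) < (1 : ℝ) / (1 / 2 : ℝ) ^ 2)
    (by positivity : (0 : ℝ) < (ρ / R) / (1 / 2 : ℝ)) hratev' hlam hlam0 hvm
    (fun a ha => ⟨(hlimw a ha).2.1.1, (hlimw a ha).2.2.1⟩)
  -- ## (9) a representative with the pointwise rate
  have h4top : typeIBound (Iio (0 : ℝ) ×ˢ univ) w ϖ H < ∞ :=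
    lt_of_le_of_lt h4I (ENNReal.mul_lt_top (by simp) hI')
  obtain ⟨v₁, hae, hP, hsing₁⟩ := exists_profile_repr hC₁ hsww hH h4top hsingw hae_rate
  -- ## (10) the zoom variables: `λⱼ • (v' ∘ λⱼ) = zoomU ν T x₀ u (R λⱼ / 2)`
  have hpt : ∀ (j : ℕ) (s : ℝ) (y : EuclideanSpace ℝ (Fin 3)),
      ((lam j) • stPull ((lam j) ^ 2) (lam j) (0 : ℝ) (0 : EuclideanSpace ℝ (Fin 3)) v') s y =
        ((R * (lam j / 2)) / ν) • u (T + (R * (lam j / 2)) ^ 2 * s / ν) (x₀ + (R * (lam j / 2)) • y) := by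
    intro j s y
    rw [smul_stPull_apply, hv', smul_stPull_apply, hv, smul_stPull_apply]
    simp only [zero_add]
    have e1 : T + β * ((1 / 2 : ℝ) ^ 2 * ((lam j) ^ 2 * s)) = T + (R * (lam j / 2)) ^ 2 * s / ν := by
      rw [hβR]; ring
    have e2 : x₀ + R • ((1 / 2 : ℝ) • ((lam j) • y)) = x₀ + (R * (lam j / 2)) • y := by
      rw [smul_smul, smul_smul, show R * (1 / 2) * lam j = R * (lam j / 2) by ring]
    rw [e1, e2, smul_smul, smul_smul, hαR, show lam j * (1 / 2) * (R / ν) = R * (lam j / 2) / ν by ring]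
  -- ## (11) Seregin's scaled energies (pressure) at the singular origin of `v'`
  obtain ⟨Ks, κ', -, r₁, hr₁, hr₁1, hKs⟩ :=
    Seregin2020.typeI_singular_scaledEnergies hsw3 hA3 hG3 hE3 hp3 hsing' hI3
  exact ⟨R, C₁, v', π', lam, w, v₁, ϖ, H, Ks, r₁, hR, hlam, hlam0, hball1, hr₁, hr₁1,
    fun r hr => le_trans le_add_self (hKs r hr).1, fun a ha => (hlimw a ha).2.2.1,
    ⟨hsww, hH, h4top, hsingw, hvm, fun a ha => (hlimw a ha).2.1.1⟩, hae, hP, hsing₁, hpt⟩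


end Summit.NavierStokesRegularity.NavierStokesRegularity.Theorems.LocalIrrotationalScarDoorZoomFrameSuitable

end
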